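import Summits.QuantumFields.YangMills.Theorems.BalabanLadderIRcofEquipartitionSeamUnitDefs
import Summits.QuantumFields.YangMills.Theorems.BalabanLadderIRRankPurityCofinalDefs
import Literature.MathematicalPhysics.QuantumFieldTheory.WilsonFinTorusTwistTensor
import Summits.QuantumFields.YangMills.Theorems.BalabanLadderIRcofThickSpeciesDatum
import HarnessLib

/-!
# Line `equipartition_seam` — BRIDGES B1 ∕ B2 PROVED (pool prover ym-ir-line-pool-p3 g16; development file, 0 sorry)

PART 1 (namespace `…KernelCurrency`) = VERBATIM COPY of ym-ir-idea-22 g6's `Lines/equipartition_seam_KernelCurrency.lean` rev 2 (6ab603a5abd8)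
§A–§C′ WITH THE THREE EDITS endorsed by ym-ir-crit-3 g5 (bus l.≈1616, 2026-08-29): (R1) `EquiWindowV` FLOOR-FREE (the `au … LowerBounds G r au →`
prefix deleted); (2) `(∀ A, 0 ≤ nrm A) ∧` in the `∃ (thick) (nrm) (β_D) (S_D)` header of `SpectralDictV`; (N-b) in `LabelNoiseOn` the dressing
constant `J` multiplies the label-class WEIGHT `μ(cls⁻¹{z₀|e})`, not `Nrm·Z_w`.  When the defs file lands in `Theorems/` with these texts, PART 1 is
deleted and replaced by its import; PART 2 becomes `Theorems/BalabanLadderIRcofEquipartitionSeamKernelBridges*.lean` (two files under the cap).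

PART 2 (namespace `…KernelBridges`): `elPart`, `withEl_elPart_eq` (electrically related ⇒ one electric family), `secZ_nonneg`,
`abs_sub_le_of_noise_of_window`, ★ **B1 `equiUnits_of_window : EquiWindowV → LabelNoiseV → SplitVanishing → EquiUnits`**,
`canonical_eblind` (peeling in the `w`-theory through the tree theorem `ThickSpeciesDatum.eblind_thick_re`, `Zc := Fin 3 → ker π` with local
`CommGroup`∕`Fintype` instances from centrality ∕ finiteness), `abs_secW_le`, `cross_transport` (J cancels identically),
★★ **B2 `eblindUnitsV_of_peeling : EquiWindowV → VacuumSlackV → SpectralDictV → LabelNoiseV → EBlindUnitsV`** with the species-uniform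
threshold `S_b = max(S_w, S_T, S_D, S_N, 1)` and constant `C(A) = 41·nrm A·C_T + C_A + 2·C_A·e^{4·thick A}`.
HONEST: bookkeeping; the located stubs S1, S3ʷ, T, D, N, S5ᵛ are untouched; width toward PXcof ∕ N_cof ∕ IRcof ∕ IR 0; Clay NOT proved.
-/

set_option linter.dupNamespace false

noncomputable section

open MeasureTheory Filter Topology
open Literature.MathematicalPhysics.QuantumFieldTheory Literature.MathematicalPhysics.QuantumLattice
open Summit.QuantumFields.YangMills.Cruxes.OSLegsFromFemtoAndGap.DlrCollarTransfer (LowerBounds)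
open Summit.QuantumFields.YangMills.Theorems.NonSimplyConnectedLatticeGap

namespace Summit.QuantumFields.YangMills.Cruxes.IRcof.EquipartitionSeam.KernelCurrency
/-! ## §A Canonical objects of the `w`-theory (Summit conventions: time = axis 0, sectors = `Sector π`) -/

section Objects

variable {G H : Type} [Group G] [TopologicalSpace G] [MeasurableSpace G] [Group H] [TopologicalSpace H]
  [IsTopologicalGroup H] [CompactSpace H] [MeasurableSpace H] [BorelSpace H]

/-- A sector `z : Plane → ker π` as a full twist tensor (upper triangle = the sector, `1` elsewhere), to be placed by the tree's
`tHooftTwistTensor` on the stacks `{x_μ = x_ν = 0}`. -/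
def sectorTensor (π : H →* G) (z : Sector π) : Fin 4 → Fin 4 → H :=
  fun μ ν => if h : μ < ν then ((z ⟨(μ, ν), h⟩ : π.ker) : H) else 1

/-- Replace the ELECTRIC part of `z` (planes `(0, i+1)`, those containing the time axis `0`) by `e : Fin 3 → ker π`. -/
def withEl (π : H →* G) (z : Sector π) (e : Fin 3 → ↥π.ker) : Sector π :=
  fun q => if q.1.1 = 0 then e ⟨(q.1.2 : ℕ) - 1, by have := q.1.2.isLt; omega⟩ else z q

/-- The electrically UNTWISTED member of `z`'s electric family (magnetic part kept). -/
def elOff (π : H →* G) (z : Sector π) : Sector π := withEl π z 1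

/-- **`Z_w(z; s × (2S+1)³)`** — the tensor-twisted partition function of the `w`-THEORY (general central plaquette weight `w : H → ℝ`;
the split weight is not of Wilson form) on the `Fin`-box with TIME extent `s` along axis `0` and spatial cube `(2S+1)³`:
`∫ ∏_x ∏_{μ<ν} w(z_{x,μν} · U_{x,μν}) dHaar` — `wilsonFinTorusTensorTwistedPartition` with the Wilson weight replaced by `w`. -/
def secZ (π : H →* G) (w : H → ℝ) (z : Sector π) (S s : ℕ) : ℝ :=
  ∫ U, ∏ x : FinTorusSite s (2 * S + 1) (2 * S + 1) (2 * S + 1), ∏ q : Plane,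
      w (tHooftTwistTensor (sectorTensor π z) x q.1.1 q.1.2 * finTorusPlaquette U x q.1.1 q.1.2)
    ∂(Measure.pi fun _ : FinTorusSite s (2 * S + 1) (2 * S + 1) (2 * S + 1) × Fin 4 => haarProbability H)

/-- **`W_{w,A}(z)`** — the `z`-twisted `w`-theory integral of the pulled-back species `Ã(V) = A.F (π ∘ torusLift V)` on the SYMMETRIC box
`(2S+1)⁴` (read through the tree's reindexing `finTorusConfigEquivSite`, which keeps the axis labels). -/
def secW (π : H →* G) (w : H → ℝ) (z : Sector π) (S : ℕ) (A : YMSpecies G) : ℝ :=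
  ∫ U, A.F (fun e => π (torusLift (2 * S + 1) ((finTorusConfigEquivSite H (2 * S + 1)).symm U) e)) *
      ∏ x : FinTorusSite (2 * S + 1) (2 * S + 1) (2 * S + 1) (2 * S + 1), ∏ q : Plane,
        w (tHooftTwistTensor (sectorTensor π z) x q.1.1 q.1.2 * finTorusPlaquette U x q.1.1 q.1.2)
    ∂(Measure.pi fun _ : FinTorusSite (2 * S + 1) (2 * S + 1) (2 * S + 1) (2 * S + 1) × Fin 4 => haarProbability H)

/-- **Principal growth rate `λ₊(w, z; S)`** `:= limsup_m Z_w(elOff z; (m+1) × (2S+1)³)^{1/(m+1)}` (the norm of the magnetically-`z`-twisted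
slice transfer operator of the `w`-theory; mirrors `WilsonTransferKernel.transferSpectralRadius`). -/
def growthRate (π : H →* G) (w : H → ℝ) (z : Sector π) (S : ℕ) : ℝ :=
  limsup (fun m : ℕ => (secZ π w (elOff π z) S (m + 1)) ^ (((m : ℝ) + 1)⁻¹)) atTop

/-! ## §B Per-`β` predicates (S3ʷ, T, D, N at one coupling ∕ one split weight) -/

/-- **S3ʷ at one `w`: EQUIPARTITION ON THE NEAR-CUBIC WINDOW beyond `S_e`** — for `S ≥ S_e`, `3(2S+1) ≤ 4s ≤ 4(2S+1)` and electrically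
related `z, z'`: `|Z_w(z; s) − Z_w(z'; s)| ≤ e^{−(2S+2)} Z_w(z'; s)`. -/
def EquiWindowOn (π : H →* G) (w : H → ℝ) (S_e : ℕ) : Prop :=
  ∀ S : ℕ, S_e ≤ S → ∀ s : ℕ, 3 * (2 * S + 1) ≤ 4 * s → s ≤ 2 * S + 1 → ∀ z z' : Sector π,
    (∀ q : Plane, q.1.1 ≠ 0 → z q = z' q) →
      |secZ π w z S s - secZ π w z' S s| ≤ Real.exp (-(2 * (S : ℝ) + 2)) * secZ π w z' S s

/-- **T at one `w`: VACUUM THERMAL SLACK beyond `S_T` with constant `C_T`** — for `S ≥ S_T`, every sector `z` and `4ϱ ≤ 2S+1`: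
`λ₊(w,z;S)^ϱ · Z_w(elOff z; 2S+1−ϱ) ≤ C_T · Z_w(elOff z; 2S+1)` (`⟨e^{ϱE}⟩_{2S+1} ≤ C_T` in the magnetic sector of `z`). -/
def VacuumSlackOn (π : H →* G) (w : H → ℝ) (C_T : ℝ) (S_T : ℕ) : Prop :=
  ∀ S : ℕ, S_T ≤ S → ∀ z : Sector π, ∀ ϱ : ℕ, 4 * ϱ ≤ 2 * S + 1 →
    growthRate π w z S ^ ϱ * secZ π w (elOff π z) S (2 * S + 1 - ϱ) ≤ C_T * secZ π w (elOff π z) S (2 * S + 1)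

/-- **D at one `w`: the SPECTRAL DICTIONARY beyond `S_D`** — per electric family (base `z₀`) a joint eigen-datum of the `w`-theory's
magnetically-twisted slice transfer operator and the electric centre-twist operators, in the currency of `ThickSpeciesDatum.eblind_thick_pow`:
`0 ≤ λᵢ ≤ λ₊`, unit multiplicative `χᵢ` on `(Fin 3 → ker π)`, `Z_w(z₀|e; m) = Σᵢ χᵢ(e) λᵢ^m` (`m ≥ 2`), and for every species `A` with
`4·thick A ≤ 2S+1` diagonal coefficients `‖dᵢ‖ ≤ nrm A · λ₊^{thick A}` with `W_{w,A}(z₀|e) = Σᵢ χᵢ(e) λᵢ^{2S+1−thick A} dᵢ`. -/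
def SpectralDictOn (π : H →* G) (w : H → ℝ) (thick : YMSpecies G → ℕ) (nrm : YMSpecies G → ℝ) (S_D : ℕ) : Prop :=
  ∀ S : ℕ, S_D ≤ S → ∀ z₀ : Sector π, ∃ (ι : Type) (lam : ι → ℝ) (χ : ι → (Fin 3 → ↥π.ker) → ℂ),
    (∀ i, 0 ≤ lam i ∧ lam i ≤ growthRate π w z₀ S) ∧ (∀ i a b, χ i (a * b) = χ i a * χ i b) ∧ (∀ i a, ‖χ i a‖ = 1) ∧
    (∀ m : ℕ, 2 ≤ m → ∀ e : Fin 3 → ↥π.ker,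
        HasSum (fun i => χ i e * ((lam i ^ m : ℝ) : ℂ)) ((secZ π w (withEl π z₀ e) S m : ℝ) : ℂ)) ∧
    (∀ A : YMSpecies G, 4 * thick A ≤ 2 * S + 1 → ∃ d : ι → ℂ,
        (∀ i, ‖d i‖ ≤ nrm A * growthRate π w z₀ S ^ thick A) ∧
        ∀ e : Fin 3 → ↥π.ker,
          HasSum (fun i => χ i e * ((lam i ^ (2 * S + 1 - thick A) : ℝ) : ℂ) * d i) ((secW π w (withEl π z₀ e) S A : ℝ) : ℂ))

/-- **N at one `(β, w)`: LABEL NOISE beyond `S_N`** — per torus `S ≥ S_N` and per MAGNETIC family (base `z₀`; members `z₀|e`,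
`e : Fin 3 → ker π`) ONE normalisation `Nrm > 0` (it absorbs the coboundary count AND the family's defect-gas factor) with
(weights) `p_{z₀|e} = Nrm · Z_w(z₀|e; 2S+1) · (1 ± e^{−(2S+1)}/8)` for every `e`, and (species) for every species `A` bounded by `C_A` ONE
dressing constant `J` (the defect-gas dressing of `A`, independent of `e`) with
`|∫_{E_{z₀|e}} Ã − Nrm · (W_{w,A}(z₀|e) + J · Z_w(z₀|e; 2S+1))| ≤ (e^{−(2S+1)}/8) · C_A · Nrm · Z_w(z₀|e; 2S+1)` for every `e`.
(`J` cancels in the EBLIND cross-difference; `Nrm` cancels in every ratio the bridges form.) -/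
def LabelNoiseOn (π : H →* G) (r : LatticeRep G) (β : ℝ) (cls : Labelling π) (w : H → ℝ) (S_N : ℕ) : Prop :=
  ∀ S : ℕ, S_N ≤ S → ∀ z₀ : Sector π, ∃ Nrm : ℝ, 0 < Nrm ∧
    (∀ e : Fin 3 → ↥π.ker,
      |((wilsonMeasure (r.ρ.comp π) β : Measure (GaugeConfig 4 (2 * S + 1) H)) ((cls S) ⁻¹' {some (withEl π z₀ e)})).toReal -
          Nrm * secZ π w (withEl π z₀ e) S (2 * S + 1)| ≤
        Real.exp (-(2 * (S : ℝ) + 1)) / 8 * (Nrm * secZ π w (withEl π z₀ e) S (2 * S + 1))) ∧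
    ∀ (A : YMSpecies G) (C_A : ℝ), (∀ U, |A.F U| ≤ C_A) → ∃ J : ℝ, ∀ e : Fin 3 → ↥π.ker,
      |(∫ V in ((cls S) ⁻¹' {some (withEl π z₀ e)}), A.F (fun e' => π (torusLift (2 * S + 1) V e'))
          ∂(wilsonMeasure (r.ρ.comp π) β : Measure (GaugeConfig 4 (2 * S + 1) H))) -
          (Nrm * secW π w (withEl π z₀ e) S A +
            J * ((wilsonMeasure (r.ρ.comp π) β : Measure (GaugeConfig 4 (2 * S + 1) H))
              ((cls S) ⁻¹' {some (withEl π z₀ e)})).toReal)| ≤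
        Real.exp (-(2 * (S : ℝ) + 1)) / 8 * C_A * (Nrm * secZ π w (withEl π z₀ e) S (2 * S + 1))

end Objects

/-! ## §C The four stub texts (rev 8 (β)): S3ʷ, T, D, N -/

/-- **S3ʷ `EquiWindowV`** — EQUI ON THE WINDOW for every admissible split weight.  Telescope = S3's (`au → 0`, floors `LowerBounds G r au`)
+ the split-noise rate `c(β)β → ∞`.  Why it might fail: as S3 — a 't Hooft-deconfined window of the `w`-theory at arbitrarily large `β` on 3:4
boxes.  Sources: 't Hooft 1979 §5; Tomboulis–Yaffe 1985; Borgs–Seiler 1983 §II. -/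
def EquiWindowV : Prop :=
  ∀ (G : Type) [Group G] [TopologicalSpace G] [IsTopologicalGroup G] [CompactSpace G] [MeasurableSpace G]
    [BorelSpace G], IsCompactSimpleLieGroup G → ∀ (H : Type) [Group H] [TopologicalSpace H] [IsTopologicalGroup H]
    [CompactSpace H] [MeasurableSpace H] [BorelSpace H], IsCompactSimpleLieGroup H → SimplyConnectedSpace H →
    ∀ (π : H →* G), Continuous π → Function.Surjective π → π.ker ≤ Subgroup.center H → (π.ker : Set H).Finite →
    π.ker ≠ ⊥ → ∀ (ρH : LatticeRep H) (r : LatticeRep G) (c : ℝ → ℝ), Tendsto (fun β => c β * β) atTop atTop →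
      ∃ (β_e : ℝ) (S_e : ℝ → ℕ), ∀ β : ℝ, β_e ≤ β → ∀ w : H → ℝ, TwistSplitWeight π ρH r (c β) β w →
        EquiWindowOn π w (S_e β)

/-- **T `VacuumSlackV`** — VACUUM SLACK for every admissible split weight, ONE constant `C_T > 0` uniform in `β ≥ β_T`, thresholds `S_T(β)`.
Why it might fail: a finite-volume Hagedorn-type proliferation of states at scale `1/(2S+1)` along the cofinal window; and its β-UNIFORM proof
is UV-flavoured (finite-size free energy at scale `1/t`, Bałaban-type input) — LOCATED-HEAVY.  Sources: 't Hooft 1979; Lüscher 1983 (femto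
universe); Bałaban 1983–89 (UV stability). -/
def VacuumSlackV : Prop :=
  ∀ (G : Type) [Group G] [TopologicalSpace G] [IsTopologicalGroup G] [CompactSpace G] [MeasurableSpace G]
    [BorelSpace G], IsCompactSimpleLieGroup G → ∀ (H : Type) [Group H] [TopologicalSpace H] [IsTopologicalGroup H]
    [CompactSpace H] [MeasurableSpace H] [BorelSpace H], IsCompactSimpleLieGroup H → SimplyConnectedSpace H →
    ∀ (π : H →* G), Continuous π → Function.Surjective π → π.ker ≤ Subgroup.center H → (π.ker : Set H).Finite →
    π.ker ≠ ⊥ → ∀ (ρH : LatticeRep H) (r : LatticeRep G) (c : ℝ → ℝ), Tendsto (fun β => c β * β) atTop atTop →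
      ∃ (C_T β_T : ℝ) (S_T : ℝ → ℕ), 0 < C_T ∧ ∀ β : ℝ, β_T ≤ β → ∀ w : H → ℝ, TwistSplitWeight π ρH r (c β) β w →
        VacuumSlackOn π w C_T (S_T β)

/-- **D `SpectralDictV`** — the SPECTRAL DICTIONARY for every admissible split weight, with species thickness `thick` and size `nrm` chosen ONCE
(independent of `β`, `S`, `w`).  Typing-provable in principle (slice kernel of the `w`-theory along axis 0 with magnetic twist and Gauss projection:
`w` of positive type ⇒ `𝕋 ⪰ 0`; trace formula `Z = tr U(e)𝕋^m`, cyclicity for the insertion, `PathKernelDomination` for `‖𝔹_A‖ ≤ ‖A‖∞ λ₊^ϱ`;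
templates `TwistedKernelTraceFormula`, `TwistedKernelFluxSectors`, `WilsonFinTorus{SliceKernel,MagneticSliceKernel,TwistedPartitionSwap}`),
M∕L-sized; why it might fail AS TYPED: a convention slip (twist orientation ∕ conjugate characters) — repairable by re-indexing. -/
def SpectralDictV : Prop :=
  ∀ (G : Type) [Group G] [TopologicalSpace G] [IsTopologicalGroup G] [CompactSpace G] [MeasurableSpace G]
    [BorelSpace G], IsCompactSimpleLieGroup G → ∀ (H : Type) [Group H] [TopologicalSpace H] [IsTopologicalGroup H]
    [CompactSpace H] [MeasurableSpace H] [BorelSpace H], IsCompactSimpleLieGroup H → SimplyConnectedSpace H →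
    ∀ (π : H →* G), Continuous π → Function.Surjective π → π.ker ≤ Subgroup.center H → (π.ker : Set H).Finite →
    π.ker ≠ ⊥ → ∀ (ρH : LatticeRep H) (r : LatticeRep G) (c : ℝ → ℝ), Tendsto (fun β => c β * β) atTop atTop →
      ∃ (thick : YMSpecies G → ℕ) (nrm : YMSpecies G → ℝ) (β_D : ℝ) (S_D : ℝ → ℕ), (∀ A, 0 ≤ nrm A) ∧
        ∀ β : ℝ, β_D ≤ β → ∀ w : H → ℝ, TwistSplitWeight π ρH r (c β) β w → SpectralDictOn π w thick nrm (S_D β)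

/-- **N `LabelNoiseV`** — LABEL NOISE for every interface labelling family and every admissible split weight, beyond thresholds `S_N(β)`,
`β ≥ β_N`.  LOCATED (the transfer dictionary's physical half): why it might fail — interface labels are not literally the twist sectors of the
exact Mack–Petkova expansion `Z_blind = N₁ Σ_z Z_w^{tw}(z)` (defect networks near the cut; the interface's `e^{−(2S+1)}` noise is in measure,
and a RELATIVE error against a suppressed sector `Z_w^{tw}(z)` needs `S ≳ ξ(β)`, whence the thresholds).  Sources: Mack–Petkova 1979;
Tomboulis 2007 (arXiv:0707.2179) §2–3; 't Hooft 1979. -/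
def LabelNoiseV : Prop :=
  ∀ (G : Type) [Group G] [TopologicalSpace G] [IsTopologicalGroup G] [CompactSpace G] [MeasurableSpace G]
    [BorelSpace G], IsCompactSimpleLieGroup G → ∀ (H : Type) [Group H] [TopologicalSpace H] [IsTopologicalGroup H]
    [CompactSpace H] [MeasurableSpace H] [BorelSpace H], IsCompactSimpleLieGroup H → SimplyConnectedSpace H →
    ∀ (π : H →* G), Continuous π → Function.Surjective π → π.ker ≤ Subgroup.center H → (π.ker : Set H).Finite →
    π.ker ≠ ⊥ → ∀ (ρH : LatticeRep H) (r : LatticeRep G) (a : ℝ) (cls : Labelling π),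
    (∀ S : ℕ, TwistSectorInterface π ρH r a S (cls S)) → ∀ c : ℝ → ℝ, Tendsto (fun β => c β * β) atTop atTop →
      ∃ (β_N : ℝ) (S_N : ℝ → ℕ), ∀ β : ℝ, β_N ≤ β → ∀ w : H → ℝ, TwistSplitWeight π ρH r (c β) β w →
        LabelNoiseOn π r β cls w (S_N β)

/-! ## §C′ Verbatim copies of the skeleton texts the bridges conclude (rev 7 l.171–210; MOVE to the defs file in rev 8) -/

/-- VERBATIM `EquipartitionSeam.SplitVanishing` (skeleton rev 7 l.171; a THEOREM there, `splitVanishing_holds`). -/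
def SplitVanishing : Prop :=
  ∀ (G : Type) [Group G] [TopologicalSpace G] [IsTopologicalGroup G] [CompactSpace G] [MeasurableSpace G]
    [BorelSpace G], IsCompactSimpleLieGroup G → ∀ (H : Type) [Group H] [TopologicalSpace H] [IsTopologicalGroup H]
    [CompactSpace H] [MeasurableSpace H] [BorelSpace H], IsCompactSimpleLieGroup H → SimplyConnectedSpace H →
    ∀ (π : H →* G), Continuous π → Function.Surjective π → π.ker ≤ Subgroup.center H → (π.ker : Set H).Finite →
    π.ker ≠ ⊥ → ∀ (ρH : LatticeRep H) (r : LatticeRep G),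
      ∃ c : ℝ → ℝ, Tendsto (fun β => c β * β) atTop atTop ∧ ∃ β_s : ℝ, ∀ β : ℝ, β_s ≤ β →
        ∃ w : H → ℝ, TwistSplitWeight π ρH r (c β) β w

/-- VERBATIM `EquipartitionSeam.EquiUnits` (S3; skeleton rev 7 l.183). -/
def EquiUnits : Prop :=
  ∀ (G : Type) [Group G] [TopologicalSpace G] [IsTopologicalGroup G] [CompactSpace G] [MeasurableSpace G]
    [BorelSpace G], IsCompactSimpleLieGroup G → ∀ (H : Type) [Group H] [TopologicalSpace H] [IsTopologicalGroup H]
    [CompactSpace H] [MeasurableSpace H] [BorelSpace H], IsCompactSimpleLieGroup H → SimplyConnectedSpace H →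
    ∀ (π : H →* G), Continuous π → Function.Surjective π → π.ker ≤ Subgroup.center H → (π.ker : Set H).Finite →
    π.ker ≠ ⊥ → ∀ (ρH : LatticeRep H) (r : LatticeRep G) (au : ℝ → ℝ), (∀ β, 0 < au β) →
    Tendsto au atTop (𝓝 0) → LowerBounds G r au → ∀ (a : ℝ) (cls : Labelling π),
    (∀ S : ℕ, TwistSectorInterface π ρH r a S (cls S)) →
      ∃ (β_e : ℝ) (S_e : ℝ → ℕ), ∀ β : ℝ, β_e ≤ β → EquiUnitOn π r β cls (S_e β)

/-- VERBATIM `EquipartitionSeam.EBlindUnitsV` (S4ᵛ; skeleton rev 7 l.198). -/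
def EBlindUnitsV : Prop :=
  ∀ (G : Type) [Group G] [TopologicalSpace G] [IsTopologicalGroup G] [CompactSpace G] [MeasurableSpace G]
    [BorelSpace G], IsCompactSimpleLieGroup G → ∀ (H : Type) [Group H] [TopologicalSpace H] [IsTopologicalGroup H]
    [CompactSpace H] [MeasurableSpace H] [BorelSpace H], IsCompactSimpleLieGroup H → SimplyConnectedSpace H →
    ∀ (π : H →* G), Continuous π → Function.Surjective π → π.ker ≤ Subgroup.center H → (π.ker : Set H).Finite →
    π.ker ≠ ⊥ → ∀ (ρH : LatticeRep H) (r : LatticeRep G) (a : ℝ) (cls : Labelling π),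
    (∀ S : ℕ, TwistSectorInterface π ρH r a S (cls S)) → ∀ c : ℝ → ℝ, Tendsto (fun β => c β * β) atTop atTop →
    ∀ β_s : ℝ, (∀ β : ℝ, β_s ≤ β → ∃ w : H → ℝ, TwistSplitWeight π ρH r (c β) β w) → ∀ (β_e : ℝ) (S_e : ℝ → ℕ),
    (∀ β : ℝ, β_e ≤ β → EquiUnitOn π r β cls (S_e β)) →
      ∃ (β_b : ℝ) (S_b : ℝ → ℕ), ∀ A : YMSpecies G, ∃ C : ℝ, ∀ β : ℝ, β_b ≤ β → EBlindUnitOn π r β cls (S_b β) A C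

end Summit.QuantumFields.YangMills.Cruxes.IRcof.EquipartitionSeam.KernelCurrency

/-! # BRIDGES (pool-p3 g16 development file; to become `Theorems/BalabanLadderIRcofEquipartitionSeamKernelBridges.lean`) -/

namespace Summit.QuantumFields.YangMills.Cruxes.IRcof.EquipartitionSeam.KernelBridges

open KernelCurrency

section Family

variable {G H : Type} [Group G] [Group H]

/-- The ELECTRIC part of a sector: its values on the three planes `(0, i+1)` containing the time axis. -/
def elPart (π : H →* G) (z : Sector π) : Fin 3 → ↥π.ker :=
  fun i => z ⟨((0 : Fin 4), i.succ), Fin.succ_pos i⟩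

/-- Two ELECTRICALLY RELATED sectors (`z q = z' q` off the time planes) lie in one electric family: `z = withEl z' (elPart z)`. -/
theorem withEl_elPart_eq (π : H →* G) {z z' : Sector π} (hrel : ∀ q : Plane, q.1.1 ≠ 0 → z q = z' q) :
    withEl π z' (elPart π z) = z := by
  funext q
  unfold withEl
  split_ifs with h
  · unfold elPart
    congr 1
    apply Subtype.ext
    have hlt : (q.1.1 : ℕ) < (q.1.2 : ℕ) := q.2
    have h0 : (q.1.1 : ℕ) = 0 := by rw [h]; rfl
    refine Prod.ext ?_ ?_
    · simpa using h.symm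
    · apply Fin.ext
      simp only [Fin.val_succ]
      omega
  · exact (hrel q h).symm

/-- In particular every sector is `withEl` of itself and its own electric part. -/
theorem withEl_elPart_self (π : H →* G) (z : Sector π) : withEl π z (elPart π z) = z :=
  withEl_elPart_eq π (fun _ _ => rfl)

/-- Members of one electric family are electrically related. -/
theorem withEl_related (π : H →* G) (z : Sector π) (e e' : Fin 3 → ↥π.ker) :
    ∀ q : Plane, q.1.1 ≠ 0 → withEl π z e q = withEl π z e' q := by
  intro q hq
  unfold withEl
  rw [if_neg hq, if_neg hq]

variable [TopologicalSpace H] [IsTopologicalGroup H] [CompactSpace H] [MeasurableSpace H] [BorelSpace H]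

/-- The `w`-theory partition functions are non-negative for a non-negative plaquette weight. -/
theorem secZ_nonneg (π : H →* G) {w : H → ℝ} (hw : ∀ h, 0 ≤ w h) (z : Sector π) (S s : ℕ) : 0 ≤ secZ π w z S s := by
  unfold secZ
  exact integral_nonneg fun U => Finset.prod_nonneg fun x _ => Finset.prod_nonneg fun q _ => hw _

end Family

/-! ## The numeric step of B1 -/

/-- **B1's ε-bookkeeping.**  Weights `p, q ≥ 0`, canonical partition functions `Zp, Zq ≥ 0`, a normalisation `N > 0`, the label noise
`|p − N·Zp| ≤ ν·N·Zp`, `|q − N·Zq| ≤ ν·N·Zq` with `ν = e^{−t}/8`, and the window equipartition `|Zp − Zq| ≤ e^{−(t+1)}·Zq` give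
`|p − q| ≤ e^{−t}·q` (indeed `≤ (13/14)·e^{−t}·q`: `2ν + η + νη ≤ (1/4 + 1/2 + 1/16)e^{−t}` with `η = e^{−t−1} ≤ e^{−t}/2`, and `q ≥ (7/8)·N·Zq`). -/
theorem abs_sub_le_of_noise_of_window {p q Zp Zq N t : ℝ} (hZp : 0 ≤ Zp) (hZq : 0 ≤ Zq) (hN : 0 < N) (ht : 0 ≤ t)
    (hp : |p - N * Zp| ≤ Real.exp (-t) / 8 * (N * Zp)) (hq : |q - N * Zq| ≤ Real.exp (-t) / 8 * (N * Zq))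
    (hZ : |Zp - Zq| ≤ Real.exp (-(t + 1)) * Zq) : |p - q| ≤ Real.exp (-t) * q := by
  set ε : ℝ := Real.exp (-t) with hε
  have hε0 : 0 < ε := Real.exp_pos _
  have hε1 : ε ≤ 1 := by rw [hε]; exact Real.exp_le_one_iff.mpr (by linarith)
  -- `e^{-(t+1)} ≤ ε / 2` since `2 ≤ e`
  have hη : Real.exp (-(t + 1)) ≤ ε / 2 := by
    have h2 : (2 : ℝ) ≤ Real.exp 1 := by
      have := Real.add_one_le_exp (1 : ℝ); linarith
    have : Real.exp (-(t + 1)) = ε * (Real.exp 1)⁻¹ := by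
      rw [hε, ← Real.exp_neg, ← Real.exp_add]; ring_nf
    rw [this]
    have hinv : (Real.exp 1)⁻¹ ≤ 1 / 2 := by
      rw [inv_eq_one_div]; exact one_div_le_one_div_of_le (by norm_num) h2
    calc ε * (Real.exp 1)⁻¹ ≤ ε * (1 / 2) := mul_le_mul_of_nonneg_left hinv hε0.le
      _ = ε / 2 := by ring
  have hNZq : 0 ≤ N * Zq := mul_nonneg hN.le hZq
  have hNZp : 0 ≤ N * Zp := mul_nonneg hN.le hZp
  -- the three-term split
  have h1 : |p - q| ≤ |p - N * Zp| + N * |Zp - Zq| + |N * Zq - q| := by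
    have hsplit : p - q = (p - N * Zp) + N * (Zp - Zq) + (N * Zq - q) := by ring
    calc |p - q| = |(p - N * Zp) + N * (Zp - Zq) + (N * Zq - q)| := by rw [← hsplit]
      _ ≤ |(p - N * Zp) + N * (Zp - Zq)| + |N * Zq - q| := abs_add_le _ _
      _ ≤ |p - N * Zp| + |N * (Zp - Zq)| + |N * Zq - q| := by gcongr; exact abs_add_le _ _
      _ = |p - N * Zp| + N * |Zp - Zq| + |N * Zq - q| := by rw [abs_mul, abs_of_pos hN]
  have hq' : |N * Zq - q| ≤ ε / 8 * (N * Zq) := by rw [abs_sub_comm]; exact hq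
  -- `N Zp ≤ (1 + ε/2) N Zq`
  have hZpq : N * Zp ≤ (1 + ε / 2) * (N * Zq) := by
    have h := (abs_le.mp (hZ.trans (mul_le_mul_of_nonneg_right hη hZq))).2
    nlinarith
  -- `q ≥ (1 − ε/8) N Zq`
  have hqlow : (1 - ε / 8) * (N * Zq) ≤ q := by
    have h := (abs_le.mp hq).1
    nlinarith
  -- assemble
  have h2 : |p - q| ≤ (ε / 8 * (1 + ε / 2) + ε / 2 + ε / 8) * (N * Zq) := by
    calc |p - q| ≤ |p - N * Zp| + N * |Zp - Zq| + |N * Zq - q| := h1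
      _ ≤ ε / 8 * (N * Zp) + N * (ε / 2 * Zq) + ε / 8 * (N * Zq) := by
          gcongr
          · exact hZ.trans (mul_le_mul_of_nonneg_right hη hZq)
      _ ≤ ε / 8 * ((1 + ε / 2) * (N * Zq)) + N * (ε / 2 * Zq) + ε / 8 * (N * Zq) := by
          gcongr
      _ = (ε / 8 * (1 + ε / 2) + ε / 2 + ε / 8) * (N * Zq) := by ring
  -- `(ε/8(1+ε/2) + ε/2 + ε/8) ≤ (13/16) ε` and `N Zq ≤ q / (7/8)`
  have hcoef : ε / 8 * (1 + ε / 2) + ε / 2 + ε / 8 ≤ 13 / 16 * ε := by nlinarith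
  have h3 : |p - q| ≤ 13 / 16 * ε * (N * Zq) :=
    h2.trans (mul_le_mul_of_nonneg_right hcoef hNZq)
  have h4 : 13 / 16 * ε * (N * Zq) ≤ ε * q := by
    -- `(7/8) N Zq ≤ (1 − ε/8) N Zq ≤ q`
    have h5 : 7 / 8 * (N * Zq) ≤ q := by nlinarith
    nlinarith
  exact h3.trans h4

/-! ## B1: S3 from S3ʷ + N + S2ᵛ -/

/-- **B1 `equiUnits_of_window`** — `EquiWindowV → LabelNoiseV → SplitVanishing → EquiUnits` (S3 as a THEOREM of rev 8 (β)).
At a cover datum: take the split rate `c` and weights `w_β` (S2ᵛ), the window thresholds `(β_e, S_e)` (S3ʷ) and the label-noise thresholds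
`(β_N, S_N)` (N); for `β ≥ max β_s β_e β_N` and `S ≥ max (S_e β) (S_N β)`, two electrically related sectors `z, z'` lie in the electric
family of `z'` (`z = withEl z' (elPart z)`), N compares `p_z, p_{z'}` with `Nrm·Z_w(·; 2S+1)` at relative noise `e^{−(2S+1)}/8`, S3ʷ at
`s = 2S+1` compares the two `Z_w` at rate `e^{−(2S+2)}`, and `abs_sub_le_of_noise_of_window` closes `|p_z − p_{z'}| ≤ e^{−(2S+1)} p_{z'}`. -/
theorem equiUnits_of_window (h3w : EquiWindowV) (hN : LabelNoiseV) (h2 : SplitVanishing) : EquiUnits := by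
  intro G _ _ _ _ _ _ hG H _ _ _ _ _ _ hH hsc π hπ hsurj hker hfin hne ρH r _au _hau _hau0 _hfloor a cls hcls
  obtain ⟨c, hc, β_s, hsplit⟩ := h2 G hG H hH hsc π hπ hsurj hker hfin hne ρH r
  obtain ⟨β_e, S_e, hEqui⟩ := h3w G hG H hH hsc π hπ hsurj hker hfin hne ρH r c hc
  obtain ⟨β_N, S_N, hNoise⟩ := hN G hG H hH hsc π hπ hsurj hker hfin hne ρH r a cls hcls c hc
  refine ⟨max β_s (max β_e β_N), fun β => max (S_e β) (S_N β), fun β hβ => ?_⟩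
  have hβs : β_s ≤ β := le_trans (le_max_left _ _) hβ
  have hβe : β_e ≤ β := le_trans ((le_max_left _ _).trans (le_max_right _ _)) hβ
  have hβN : β_N ≤ β := le_trans ((le_max_right _ _).trans (le_max_right _ _)) hβ
  obtain ⟨w, hw⟩ := hsplit β hβs
  have hw0 : ∀ h, 0 ≤ w h := hw.2.1
  have hEq := hEqui β hβe w hw
  have hNo := hNoise β hβN w hw
  intro S z z' hS hzz'
  have hSe : S_e β ≤ S := le_trans (le_max_left _ _) hS
  have hSN : S_N β ≤ S := le_trans (le_max_right _ _) hS
  obtain ⟨Nrm, hNrm, hp, -⟩ := hNo S hSN z'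
  have hpz := hp (elPart π z)
  have hpz' := hp (elPart π z')
  rw [withEl_elPart_eq π hzz'] at hpz
  rw [withEl_elPart_self π z'] at hpz'
  have hwin := hEq S hSe (2 * S + 1) (by omega) le_rfl (withEl π z' (elPart π z)) (withEl π z' (elPart π z'))
    (withEl_related π z' _ _)
  rw [withEl_elPart_eq π hzz', withEl_elPart_self π z'] at hwin
  have ht : (0 : ℝ) ≤ 2 * (S : ℝ) + 1 := by positivity
  have hexp : Real.exp (-(2 * (S : ℝ) + 2)) = Real.exp (-((2 * (S : ℝ) + 1) + 1)) := by ring_nf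
  rw [hexp] at hwin
  exact abs_sub_le_of_noise_of_window (secZ_nonneg π hw0 _ _ _) (secZ_nonneg π hw0 _ _ _) hNrm ht hpz hpz' hwin

/-! ## B2, canonical half: the PEELING bound in the `w`-theory (N-independent) -/

section Canonical

variable {G H : Type} [Group G] [MeasurableSpace G] [Group H] [TopologicalSpace H]
  [IsTopologicalGroup H] [CompactSpace H] [MeasurableSpace H] [BorelSpace H]

/-- `e⁻² ≤ 1/2` (so the window rate `e^{−(2S+2)}` is an admissible defect `δ ≤ 1/2` for `eblind_thick_re`). -/
theorem exp_neg_two_S_two_le_half (S : ℕ) : Real.exp (-(2 * (S : ℝ) + 2)) ≤ 1 / 2 := by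
  have h1 : Real.exp (-(2 * (S : ℝ) + 2)) ≤ Real.exp (-1) :=
    Real.exp_le_exp.mpr (by have : (0:ℝ) ≤ S := Nat.cast_nonneg S; linarith)
  have h2 : Real.exp (-1) ≤ 1 / 2 := by
    have h := Real.add_one_le_exp (1 : ℝ)
    rw [Real.exp_neg, inv_eq_one_div]
    exact one_div_le_one_div_of_le (by norm_num) (by linarith)
  exact h1.trans h2

/-- **B2, canonical half (PEELING in the `w`-theory).**  At one split weight `w ≥ 0` with window equipartition beyond `S_e`, vacuum slack
`(C_T, S_T)` and the spectral dictionary `(thick, nrm ≥ 0, S_D)`: for `S ≥ max(S_e, S_T, S_D, 1)`, a species `A` in the peeling regime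
`4·thick A ≤ 2S+1`, a family base `z₀` and two electric parts `e, e'`,
`|W_A(z₀|e)·Z(z₀|e') − W_A(z₀|e')·Z(z₀|e)| ≤ 40·(nrm A·C_T)·e^{−(2S+2)}·Z(z₀|e)·Z(z₀|e')` (`Z = Z_w(·; 2S+1)`) — the tree theorem
`ThickSpeciesDatum.eblind_thick_re` over `Zc := Fin 3 → ker π` (abelian by centrality, finite by `(ker π).Finite`), fed with D's eigen-datum
at extents `2S+1 − thick A` and `2S+1`, EQUI from S3ʷ at both extents (rate `e^{−(2S+2)} ≤ 1/2`) between each member and `elOff z₀`, and the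
slack from T at `ϱ = thick A`. -/
theorem canonical_eblind (π : H →* G) (hker : π.ker ≤ Subgroup.center H) (hfin : (π.ker : Set H).Finite)
    {w : H → ℝ} (hw0 : ∀ h, 0 ≤ w h) {S_e : ℕ} (hEq : EquiWindowOn π w S_e) {C_T : ℝ} {S_T : ℕ}
    (hSl : VacuumSlackOn π w C_T S_T) {thick : YMSpecies G → ℕ} {nrm : YMSpecies G → ℝ} {S_D : ℕ}
    (hCT : 0 ≤ C_T) (hDi : SpectralDictOn π w thick nrm S_D) (A : YMSpecies G) (hnrm : 0 ≤ nrm A) (S : ℕ)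
    (hS1 : 1 ≤ S)
    (hSe : S_e ≤ S) (hST : S_T ≤ S) (hSD : S_D ≤ S) (hthick : 4 * thick A ≤ 2 * S + 1) (z₀ : Sector π)
    (e e' : Fin 3 → ↥π.ker) :
    |secW π w (withEl π z₀ e) S A * secZ π w (withEl π z₀ e') S (2 * S + 1) -
        secW π w (withEl π z₀ e') S A * secZ π w (withEl π z₀ e) S (2 * S + 1)| ≤
      40 * (nrm A * C_T) * Real.exp (-(2 * (S : ℝ) + 2)) *
        secZ π w (withEl π z₀ e) S (2 * S + 1) * secZ π w (withEl π z₀ e') S (2 * S + 1) := by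
  -- instances on the electric twist group `Fin 3 → ker π`
  haveI : Finite ↥π.ker := hfin.to_subtype
  letI : Fintype ↥π.ker := Fintype.ofFinite _
  letI : CommGroup ↥π.ker :=
    { (inferInstance : Group ↥π.ker) with
      mul_comm := fun a b => Subtype.ext (Subgroup.mem_center_iff.mp (hker b.2) a) }
  -- unpack the dictionary at `(S, z₀)`
  obtain ⟨ι, lam, χ, hlam, hmul, hnorm1, hZs, hAs⟩ := hDi S hSD z₀
  obtain ⟨d, hd, hWs⟩ := hAs A hthick
  set t : ℕ := 2 * S + 1 with ht
  set ϱ : ℕ := thick A with hϱ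
  set Λ : ℝ := growthRate π w z₀ S with hΛ
  have hsϱ : 2 ≤ t - ϱ := by omega
  have h3 : 3 * (2 * S + 1) ≤ 4 * (t - ϱ) := by omega
  have h4 : t - ϱ ≤ 2 * S + 1 := by omega
  have h1 : ∀ i, χ i 1 = 1 := fun i => ThickSpeciesDatum.char_one (χ i) (hmul i) (hnorm1 i)
  -- the data at extent `t − ϱ` (block X) and `t` (block Z)
  set X₁ : ℝ := secZ π w (withEl π z₀ 1) S (t - ϱ) with hX₁
  set Z₀ : ℝ := secZ π w (withEl π z₀ 1) S t with hZ₀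
  have hX1 : HasSum (fun i => lam i ^ (t - ϱ)) X₁ := by
    have h := hZs (t - ϱ) hsϱ 1
    simp only [h1, one_mul] at h
    exact Complex.hasSum_ofReal.mp h
  have hZ1 : HasSum (fun i => lam i ^ t) Z₀ := by
    have h := hZs t (by omega) 1
    simp only [h1, one_mul] at h
    exact Complex.hasSum_ofReal.mp h
  have hZ₀0 : 0 ≤ Z₀ := secZ_nonneg π hw0 _ _ _
  -- equipartition at both extents (S3ʷ), as complex-norm statements about the real casts
  have hequiX : ∀ c : Fin 3 → ↥π.ker,
      ‖((secZ π w (withEl π z₀ c) S (t - ϱ) : ℝ) : ℂ) - (X₁ : ℂ)‖ ≤ Real.exp (-(2 * (S : ℝ) + 2)) * X₁ := by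
    intro c
    rw [← Complex.ofReal_sub, Complex.norm_real, Real.norm_eq_abs]
    exact hEq S hSe (t - ϱ) h3 h4 (withEl π z₀ c) (withEl π z₀ 1) (withEl_related π z₀ c 1)
  have hequiZ : ∀ c : Fin 3 → ↥π.ker,
      ‖((secZ π w (withEl π z₀ c) S t : ℝ) : ℂ) - (Z₀ : ℂ)‖ ≤ Real.exp (-(2 * (S : ℝ) + 2)) * Z₀ := by
    intro c
    rw [← Complex.ofReal_sub, Complex.norm_real, Real.norm_eq_abs]
    exact hEq S hSe t (by omega) le_rfl (withEl π z₀ c) (withEl π z₀ 1) (withEl_related π z₀ c 1)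
  -- the slack (T) at `ϱ = thick A`
  have hslack : (nrm A * Λ ^ ϱ) * X₁ ≤ (nrm A * C_T) * Z₀ := by
    have h := hSl S hST z₀ ϱ hthick
    -- `elOff z₀ = withEl z₀ 1` by definition
    have hX₁' : secZ π w (elOff π z₀) S (2 * S + 1 - ϱ) = X₁ := rfl
    have hZ₀' : secZ π w (elOff π z₀) S (2 * S + 1) = Z₀ := rfl
    rw [hX₁', hZ₀'] at h
    calc (nrm A * Λ ^ ϱ) * X₁ = nrm A * (Λ ^ ϱ * X₁) := by ring
      _ ≤ nrm A * (C_T * Z₀) := mul_le_mul_of_nonneg_left h hnrm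
      _ = (nrm A * C_T) * Z₀ := by ring
  have hδ0 : 0 ≤ Real.exp (-(2 * (S : ℝ) + 2)) := (Real.exp_pos _).le
  have hK : 0 ≤ nrm A * C_T := mul_nonneg hnrm hCT
  have hmain := ThickSpeciesDatum.eblind_thick_re (Zc := Fin 3 → ↥π.ker) (fun i => lam i ^ (t - ϱ))
    (fun i => pow_nonneg (hlam i).1 _) χ hmul hnorm1 d hd (fun c => hZs (t - ϱ) hsϱ c) hX1 hWs hequiX hZ₀0 hequiZ
    hδ0 (exp_neg_two_S_two_le_half S) hK hslack e e'
  have hre : ∀ c : Fin 3 → ↥π.ker, (((secZ π w (withEl π z₀ c) S t : ℝ) : ℂ)).re = secZ π w (withEl π z₀ c) S t :=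
    fun c => Complex.ofReal_re _
  rw [hre, hre, ← Complex.ofReal_mul, ← Complex.ofReal_mul, ← Complex.ofReal_sub, Complex.norm_real,
    Real.norm_eq_abs] at hmain
  exact hmain

end Canonical

/-! ## B2, canonical half (continued): the insertion bound `|W_A(z₀|e)| ≤ 2·(nrm A·C_T)·Z(z₀|e)` -/

section CanonicalW

variable {G H : Type} [Group G] [MeasurableSpace G] [Group H] [TopologicalSpace H]
  [IsTopologicalGroup H] [CompactSpace H] [MeasurableSpace H] [BorelSpace H]

/-- **Twisted insertion bound** from D + T + S3ʷ: `|W_A(z₀|e)| ≤ nrm A·λ₊^{ϱ}·Z(elOff z₀; t−ϱ) ≤ nrm A·C_T·Z(elOff z₀; t) ≤ 2·nrm A·C_T·Z(z₀|e; t)`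
(`‖χᵢ(e)‖ = 1`, `‖dᵢ‖ ≤ nrm A·λ₊^ϱ`; slack; `Z₀ ≤ 2 Z_e` from the window EQUI at rate `≤ 1/2`). -/
theorem abs_secW_le (π : H →* G) {w : H → ℝ} (hw0 : ∀ h, 0 ≤ w h) {S_e : ℕ} (hEq : EquiWindowOn π w S_e)
    {C_T : ℝ} {S_T : ℕ} (hSl : VacuumSlackOn π w C_T S_T) (hCT : 0 ≤ C_T) {thick : YMSpecies G → ℕ}
    {nrm : YMSpecies G → ℝ} {S_D : ℕ} (hDi : SpectralDictOn π w thick nrm S_D) (A : YMSpecies G) (hnrm : 0 ≤ nrm A)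
    (hker : π.ker ≤ Subgroup.center H)
    (S : ℕ) (hS1 : 1 ≤ S) (hSe : S_e ≤ S) (hST : S_T ≤ S) (hSD : S_D ≤ S) (hthick : 4 * thick A ≤ 2 * S + 1)
    (z₀ : Sector π) (e : Fin 3 → ↥π.ker) :
    |secW π w (withEl π z₀ e) S A| ≤ 2 * (nrm A * C_T) * secZ π w (withEl π z₀ e) S (2 * S + 1) := by
  letI : CommGroup ↥π.ker :=
    { (inferInstance : Group ↥π.ker) with
      mul_comm := fun a b => Subtype.ext (Subgroup.mem_center_iff.mp (hker b.2) a) }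
  obtain ⟨ι, lam, χ, hlam, hmul, hnorm1, hZs, hAs⟩ := hDi S hSD z₀
  obtain ⟨d, hd, hWs⟩ := hAs A hthick
  set t : ℕ := 2 * S + 1 with ht
  set ϱ : ℕ := thick A with hϱ
  set Λ : ℝ := growthRate π w z₀ S with hΛ
  have hsϱ : 2 ≤ t - ϱ := by omega
  have h3 : 3 * (2 * S + 1) ≤ 4 * (t - ϱ) := by omega
  have h1 : ∀ i, χ i 1 = 1 := fun i => ThickSpeciesDatum.char_one (χ i) (hmul i) (hnorm1 i)
  set X₁ : ℝ := secZ π w (withEl π z₀ 1) S (t - ϱ) with hX₁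
  set Z₀ : ℝ := secZ π w (withEl π z₀ 1) S t with hZ₀
  set Ze : ℝ := secZ π w (withEl π z₀ e) S t with hZe
  have hX1 : HasSum (fun i => lam i ^ (t - ϱ)) X₁ := by
    have h := hZs (t - ϱ) hsϱ 1
    simp only [h1, one_mul] at h
    exact Complex.hasSum_ofReal.mp h
  have hZ₀0 : 0 ≤ Z₀ := secZ_nonneg π hw0 _ _ _
  -- Step 1: `‖W e‖ ≤ (nrm A · Λ^ϱ) · X₁` termwise
  have hWnorm : ‖((secW π w (withEl π z₀ e) S A : ℝ) : ℂ)‖ ≤ (nrm A * Λ ^ ϱ) * X₁ := by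
    refine (hWs e).norm_le_of_bounded (hX1.mul_left (nrm A * Λ ^ ϱ)) (fun i => ?_)
    rw [norm_mul, norm_mul, hnorm1, one_mul, Complex.norm_real, Real.norm_eq_abs,
      abs_of_nonneg (pow_nonneg (hlam i).1 _), mul_comm]
    exact mul_le_mul_of_nonneg_right (hd i) (pow_nonneg (hlam i).1 _)
  rw [Complex.norm_real, Real.norm_eq_abs] at hWnorm
  -- Step 2: slack `Λ^ϱ X₁ ≤ C_T Z₀`
  have hslack : (nrm A * Λ ^ ϱ) * X₁ ≤ (nrm A * C_T) * Z₀ := by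
    have h := hSl S hST z₀ ϱ hthick
    have hX₁' : secZ π w (elOff π z₀) S (2 * S + 1 - ϱ) = X₁ := rfl
    have hZ₀' : secZ π w (elOff π z₀) S (2 * S + 1) = Z₀ := rfl
    rw [hX₁', hZ₀'] at h
    calc (nrm A * Λ ^ ϱ) * X₁ = nrm A * (Λ ^ ϱ * X₁) := by ring
      _ ≤ nrm A * (C_T * Z₀) := mul_le_mul_of_nonneg_left h hnrm
      _ = (nrm A * C_T) * Z₀ := by ring
  -- Step 3: `Z₀ ≤ 2 Ze` from EQUI at extent `t` (rate ≤ 1/2)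
  have hZ2 : Z₀ ≤ 2 * Ze := by
    have h := hEq S hSe t (by omega) le_rfl (withEl π z₀ e) (withEl π z₀ 1) (withEl_related π z₀ e 1)
    have hhalf := exp_neg_two_S_two_le_half S
    have hlow := (abs_le.mp h).1
    -- `Ze − Z₀ ≥ −e^{−(2S+2)} Z₀ ≥ −Z₀/2`
    have : Real.exp (-(2 * (S : ℝ) + 2)) * Z₀ ≤ 1 / 2 * Z₀ := mul_le_mul_of_nonneg_right hhalf hZ₀0
    simp only [hZe, ht]
    linarith
  calc |secW π w (withEl π z₀ e) S A| ≤ (nrm A * Λ ^ ϱ) * X₁ := hWnorm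
    _ ≤ (nrm A * C_T) * Z₀ := hslack
    _ ≤ (nrm A * C_T) * (2 * Ze) := mul_le_mul_of_nonneg_left hZ2 (mul_nonneg hnrm hCT)
    _ = 2 * (nrm A * C_T) * secZ π w (withEl π z₀ e) S (2 * S + 1) := by simp only [hZe, ht]; ring

end CanonicalW

/-! ## B2, transport half: pure real bookkeeping -/

/-- **Cross-difference transport through the label noise.**  Weights `p = N·Z + r`, `p' = N·Z' + r'` (`|r| ≤ νNZ`, `|r'| ≤ νNZ'`),
integrals `I = N·W + J·p + q`, `I' = N·W' + J·p' + q'` (`|q| ≤ νC·NZ`, `|q'| ≤ νC·NZ'` — `J` anchored on the weight, so it cancels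
identically), the canonical cross bound `|W·Z' − W'·Z| ≤ M·Z·Z'` and the insertion bounds `|W| ≤ 2K·Z`, `|W'| ≤ 2K·Z'`, with `ν ≤ 1/8`,
give `|p'·I − p·I'| ≤ 2·(M + 4Kν + 4Cν)·p·p'`. -/
theorem cross_transport {p p' I I' W W' Z Z' N J ν C K M : ℝ}
    (hZ : 0 ≤ Z) (hZ' : 0 ≤ Z') (hN : 0 ≤ N) (hν0 : 0 ≤ ν) (hν : ν ≤ 1 / 8)
    (hC : 0 ≤ C) (hK : 0 ≤ K) (hM : 0 ≤ M)
    (hpe : |p - N * Z| ≤ ν * (N * Z)) (hpe' : |p' - N * Z'| ≤ ν * (N * Z'))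
    (hI : |I - (N * W + J * p)| ≤ ν * C * (N * Z)) (hI' : |I' - (N * W' + J * p')| ≤ ν * C * (N * Z'))
    (hcross : |W * Z' - W' * Z| ≤ M * Z * Z') (hW : |W| ≤ 2 * K * Z) (hW' : |W'| ≤ 2 * K * Z') :
    |p' * I - p * I'| ≤ 2 * (M + 4 * K * ν + 4 * C * ν) * (p * p') := by
  have hNZ : 0 ≤ N * Z := mul_nonneg hN hZ
  have hNZ' : 0 ≤ N * Z' := mul_nonneg hN hZ'
  -- weights are ≥ (1 − ν) N Z ≥ 0, in particular ≥ (7/8) N Z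
  have hp_low : 7 / 8 * (N * Z) ≤ p := by have := (abs_le.mp hpe).1; nlinarith
  have hp'_low : 7 / 8 * (N * Z') ≤ p' := by have := (abs_le.mp hpe').1; nlinarith
  have hp0 : 0 ≤ p := le_trans (by positivity) hp_low
  have hp0' : 0 ≤ p' := le_trans (by positivity) hp'_low
  have hp_up : p ≤ 9 / 8 * (N * Z) := by have := (abs_le.mp hpe).2; nlinarith
  have hp'_up : p' ≤ 9 / 8 * (N * Z') := by have := (abs_le.mp hpe').2; nlinarith
  -- decomposition: `p' I − p I' = N·(p' W − p W') + (p' q − p q')`, `p' W − p W' = N(Z' W − Z W') + r' W − r W'`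
  set r : ℝ := p - N * Z with hr
  set r' : ℝ := p' - N * Z' with hr'
  set q : ℝ := I - (N * W + J * p) with hq
  set q' : ℝ := I' - (N * W' + J * p') with hq'
  have key : p' * I - p * I' = N * (N * (Z' * W - Z * W') + (r' * W - r * W')) + (p' * q - p * q') := by
    simp only [hr, hr', hq, hq']; ring
  rw [key]
  have h1 : |N * (Z' * W - Z * W')| ≤ N * (M * Z * Z') := by
    rw [abs_mul, abs_of_nonneg hN]
    refine mul_le_mul_of_nonneg_left ?_ hN
    have : Z' * W - Z * W' = W * Z' - W' * Z := by ring
    rw [this]; exact hcross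
  have h2 : |r' * W| ≤ ν * (N * Z') * (2 * K * Z) := by
    rw [abs_mul]; exact mul_le_mul hpe' hW (abs_nonneg _) (mul_nonneg hν0 hNZ')
  have h3 : |r * W'| ≤ ν * (N * Z) * (2 * K * Z') := by
    rw [abs_mul]; exact mul_le_mul hpe hW' (abs_nonneg _) (mul_nonneg hν0 hNZ)
  have h4 : |p' * q| ≤ (9 / 8 * (N * Z')) * (ν * C * (N * Z)) := by
    rw [abs_mul, abs_of_nonneg hp0']; exact mul_le_mul hp'_up hI (abs_nonneg _) (by positivity)
  have h5 : |p * q'| ≤ (9 / 8 * (N * Z)) * (ν * C * (N * Z')) := by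
    rw [abs_mul, abs_of_nonneg hp0]; exact mul_le_mul hp_up hI' (abs_nonneg _) (by positivity)
  have hsum : |N * (N * (Z' * W - Z * W') + (r' * W - r * W')) + (p' * q - p * q')| ≤
      N * (N * (M * Z * Z') + (ν * (N * Z') * (2 * K * Z) + ν * (N * Z) * (2 * K * Z'))) +
        ((9 / 8 * (N * Z')) * (ν * C * (N * Z)) + (9 / 8 * (N * Z)) * (ν * C * (N * Z'))) := by
    refine (abs_add_le _ _).trans (add_le_add ?_ ?_)
    · rw [abs_mul, abs_of_nonneg hN]
      refine mul_le_mul_of_nonneg_left ?_ hN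
      refine (abs_add_le _ _).trans (add_le_add h1 ?_)
      exact (abs_sub _ _).trans (add_le_add h2 h3)
    · exact (abs_sub _ _).trans (add_le_add h4 h5)
  refine hsum.trans ?_
  -- everything is a multiple of `(N Z)(N Z')`; compare with `p p' ≥ (7/8)² (N Z)(N Z')`
  have hprod : (N * Z) * (N * Z') ≤ 64 / 49 * (p * p') := by
    have := mul_le_mul hp_low hp'_low (by positivity) hp0
    nlinarith
  have hcoef : 0 ≤ M + 4 * K * ν + 9 / 4 * C * ν := by positivity
  calc N * (N * (M * Z * Z') + (ν * (N * Z') * (2 * K * Z) + ν * (N * Z) * (2 * K * Z'))) +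
        ((9 / 8 * (N * Z')) * (ν * C * (N * Z)) + (9 / 8 * (N * Z)) * (ν * C * (N * Z')))
      = (M + 4 * K * ν + 9 / 4 * C * ν) * ((N * Z) * (N * Z')) := by ring
    _ ≤ (M + 4 * K * ν + 9 / 4 * C * ν) * (64 / 49 * (p * p')) := mul_le_mul_of_nonneg_left hprod hcoef
    _ ≤ 2 * (M + 4 * K * ν + 4 * C * ν) * (p * p') := by
        have hpp : 0 ≤ p * p' := mul_nonneg hp0 hp0'
        nlinarith [mul_nonneg (mul_nonneg hC hν0) hpp, mul_nonneg hM hpp, mul_nonneg (mul_nonneg hK hν0) hpp]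

/-! ## B2: S4ᵛ from S3ʷ + T + D + N -/

section Assembly

/-- `e^{−(t+1)} ≤ e^{−t}/2`. -/
theorem exp_neg_succ_le_half (t : ℝ) : Real.exp (-(t + 1)) ≤ Real.exp (-t) / 2 := by
  have h2 : (2 : ℝ) ≤ Real.exp 1 := by have := Real.add_one_le_exp (1 : ℝ); linarith
  have : Real.exp (-(t + 1)) = Real.exp (-t) * (Real.exp 1)⁻¹ := by
    rw [← Real.exp_neg, ← Real.exp_add]; ring_nf
  rw [this, div_eq_mul_inv]
  exact mul_le_mul_of_nonneg_left ((inv_le_inv₀ (by positivity) (by norm_num)).mpr h2) (Real.exp_pos _).le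

/-- **B2 `eblindUnitsV_of_peeling`** — `EquiWindowV → VacuumSlackV → SpectralDictV → LabelNoiseV → EBlindUnitsV` (S4ᵛ as a THEOREM of rev 8 (β)).
Per species `A`: constant `C(A) = 41·nrm A·C_T + C_A + 2·C_A·e^{4·thick A}` (`C_A` from `A.bounded`), thresholds `S_b(β) = max(S_e, S_T, S_D, S_N, 1)`
— species-UNIFORM.  For `4·thick A ≤ 2S+1`: the canonical peeling bound (`canonical_eblind`, via `ThickSpeciesDatum.eblind_thick_re`) and
the insertion bounds (`abs_secW_le`) are transported to label classes by N (`cross_transport`; `J` cancels identically); rate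
`2(40K e^{−(t+1)} + 4Kν + 4C_Aν) ≤ (41K + C_A)e^{−t}`.  For the finitely many `S` with `4·thick A > 2S+1`: the trivial bound `2C_A p_z p_{z'}`
(species bound) `≤ 2C_A e^{4 thick A} e^{−t} p_z p_{z'}`. -/
theorem eblindUnitsV_of_peeling (h3w : EquiWindowV) (hT : VacuumSlackV) (hD : SpectralDictV) (hN : LabelNoiseV) :
    EBlindUnitsV := by
  intro G _ _ _ _ _ _ hG H _ _ _ _ _ _ hH hsc π hπ hsurj hker hfin hne ρH r a cls hcls c hc β_s hsplit _β_e0 _S_e0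
    _hequi0
  obtain ⟨β_w, S_w, hWin⟩ := h3w G hG H hH hsc π hπ hsurj hker hfin hne ρH r c hc
  obtain ⟨C_T, β_T, S_T, hCT, hSlack⟩ := hT G hG H hH hsc π hπ hsurj hker hfin hne ρH r c hc
  obtain ⟨thick, nrm, β_D, S_D, hnrm, hDict⟩ := hD G hG H hH hsc π hπ hsurj hker hfin hne ρH r c hc
  obtain ⟨β_N, S_N, hNoi⟩ := hN G hG H hH hsc π hπ hsurj hker hfin hne ρH r a cls hcls c hc
  refine ⟨max (max β_s β_w) (max β_T (max β_D β_N)),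
    fun β => max (max (S_w β) (S_T β)) (max (S_D β) (max (S_N β) 1)), fun A => ?_⟩
  obtain ⟨C_A, hC_A⟩ := A.bounded
  have hCA0 : 0 ≤ C_A := (abs_nonneg _).trans (hC_A (fun _ => 1))
  set K : ℝ := nrm A * C_T with hKdef
  have hK0 : 0 ≤ K := mul_nonneg (hnrm A) hCT.le
  refine ⟨41 * K + C_A + 2 * C_A * Real.exp (4 * (thick A : ℝ)), fun β hβ => ?_⟩
  have hβs : β_s ≤ β := le_trans ((le_max_left _ _).trans (le_max_left _ _)) hβ
  have hβw : β_w ≤ β := le_trans ((le_max_right _ _).trans (le_max_left _ _)) hβ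
  have hβT : β_T ≤ β := le_trans ((le_max_left _ _).trans (le_max_right _ _)) hβ
  have hβD : β_D ≤ β := le_trans (((le_max_left _ _).trans (le_max_right _ _)).trans (le_max_right _ _)) hβ
  have hβN : β_N ≤ β := le_trans (((le_max_right _ _).trans (le_max_right _ _)).trans (le_max_right _ _)) hβ
  obtain ⟨w, hw⟩ := hsplit β hβs
  have hw0 : ∀ h, 0 ≤ w h := hw.2.1
  have hEq := hWin β hβw w hw
  have hSl := hSlack β hβT w hw
  have hDi := hDict β hβD w hw
  have hNo := hNoi β hβN w hw
  intro S z z' hS hrel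
  have hSw : S_w β ≤ S := le_trans ((le_max_left _ _).trans (le_max_left _ _)) hS
  have hST : S_T β ≤ S := le_trans ((le_max_right _ _).trans (le_max_left _ _)) hS
  have hSD : S_D β ≤ S := le_trans ((le_max_left _ _).trans (le_max_right _ _)) hS
  have hSN : S_N β ≤ S := le_trans (((le_max_left _ _).trans (le_max_right _ _)).trans (le_max_right _ _)) hS
  have hS1 : 1 ≤ S := le_trans (((le_max_right _ _).trans (le_max_right _ _)).trans (le_max_right _ _)) hS
  -- the blind cover measure on this torus is a probability measure
  haveI := isProbabilityMeasure_wilsonMeasure (d := 4) (L := 2 * S + 1) (r.ρ.comp π) (r.continuous.comp hπ) β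
  set μ : Measure (GaugeConfig 4 (2 * S + 1) H) := wilsonMeasure (r.ρ.comp π) β with hμ
  -- N at `(S, z')`: normalisation, weights, dressing
  obtain ⟨Nrm, hNrm, hpN, hIN⟩ := hNo S hSN z'
  obtain ⟨J, hJ⟩ := hIN A C_A hC_A
  have hz : withEl π z' (elPart π z) = z := withEl_elPart_eq π hrel
  have hz' : withEl π z' (elPart π z') = z' := withEl_elPart_self π z'
  have hpz := hpN (elPart π z)
  have hpz' := hpN (elPart π z')
  have hIz := hJ (elPart π z)
  have hIz' := hJ (elPart π z')
  rw [hz] at hpz hIz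
  rw [hz'] at hpz' hIz'
  set t : ℝ := 2 * (S : ℝ) + 1 with htdef
  set ν : ℝ := Real.exp (-t) / 8 with hνdef
  have hν0 : 0 ≤ ν := by positivity
  have hν8 : ν ≤ 1 / 8 := by
    have hexp1 : Real.exp (-t) ≤ 1 :=
      Real.exp_le_one_iff.mpr (by rw [htdef]; have : (0:ℝ) ≤ S := Nat.cast_nonneg S; linarith)
    rw [hνdef]
    linarith
  set pz : ℝ := (μ ((cls S) ⁻¹' {some z})).toReal with hpzdef
  set pz' : ℝ := (μ ((cls S) ⁻¹' {some z'})).toReal with hpz'def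
  have hpz0 : 0 ≤ pz := ENNReal.toReal_nonneg
  have hpz'0 : 0 ≤ pz' := ENNReal.toReal_nonneg
  have hZz : 0 ≤ secZ π w z S (2 * S + 1) := secZ_nonneg π hw0 _ _ _
  have hZz' : 0 ≤ secZ π w z' S (2 * S + 1) := secZ_nonneg π hw0 _ _ _
  have hexp_t : Real.exp (-(2 * (S : ℝ) + 1)) = Real.exp (-t) := by rw [htdef]
  by_cases hreg : 4 * thick A ≤ 2 * S + 1
  · -- PEELING regime
    have hcross := canonical_eblind π hker hfin hw0 hEq hSl hCT.le hDi A (hnrm A) S hS1 hSw hST hSD hreg z'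
      (elPart π z) (elPart π z')
    have hWz := abs_secW_le π hw0 hEq hSl hCT.le hDi A (hnrm A) hker S hS1 hSw hST hSD hreg z' (elPart π z)
    have hWz' := abs_secW_le π hw0 hEq hSl hCT.le hDi A (hnrm A) hker S hS1 hSw hST hSD hreg z' (elPart π z')
    rw [hz, hz'] at hcross
    rw [hz] at hWz
    rw [hz'] at hWz'
    have hM0 : 0 ≤ 40 * (nrm A * C_T) * Real.exp (-(2 * (S : ℝ) + 2)) := by positivity
    have htr := cross_transport hZz hZz' hNrm.le hν0 hν8 hCA0 hK0 hM0 hpz hpz' hIz hIz' hcross hWz hWz'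
    refine htr.trans ?_
    have hδ : Real.exp (-(2 * (S : ℝ) + 2)) ≤ Real.exp (-t) / 2 := by
      have := exp_neg_succ_le_half t
      rw [htdef] at this ⊢
      have h' : -(2 * (S : ℝ) + 1 + 1) = -(2 * (S : ℝ) + 2) := by ring
      rw [h'] at this
      exact this
    have hpp : 0 ≤ pz * pz' := mul_nonneg hpz0 hpz'0
    have hrate : 2 * (40 * (nrm A * C_T) * Real.exp (-(2 * (S : ℝ) + 2)) + 4 * K * ν + 4 * C_A * ν) ≤
        (41 * K + C_A + 2 * C_A * Real.exp (4 * (thick A : ℝ))) * Real.exp (-(2 * (S : ℝ) + 1)) := by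
      rw [hexp_t, hνdef]
      have h1 : 0 ≤ 2 * C_A * Real.exp (4 * (thick A : ℝ)) * Real.exp (-t) := by positivity
      have h2 : 40 * (nrm A * C_T) * Real.exp (-(2 * (S : ℝ) + 2)) ≤ 40 * K * (Real.exp (-t) / 2) := by
        rw [hKdef]; exact mul_le_mul_of_nonneg_left hδ (by positivity)
      nlinarith [h1, h2, Real.exp_pos (-t), hK0, hCA0]
    calc 2 * (40 * (nrm A * C_T) * Real.exp (-(2 * (S : ℝ) + 2)) + 4 * K * ν + 4 * C_A * ν) * (pz * pz')
        ≤ (41 * K + C_A + 2 * C_A * Real.exp (4 * (thick A : ℝ))) * Real.exp (-(2 * (S : ℝ) + 1)) * (pz * pz') :=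
          mul_le_mul_of_nonneg_right hrate hpp
      _ = (41 * K + C_A + 2 * C_A * Real.exp (4 * (thick A : ℝ))) * Real.exp (-(2 * (S : ℝ) + 1)) * pz * pz' := by
          ring
  · -- SMALL-S regime: trivial bound from the species bound
    have hreg' : 2 * S + 1 < 4 * thick A := not_le.mp hreg
    have hIle : ∀ (zz : Sector π), |∫ V in ((cls S) ⁻¹' {some zz}), A.F (fun e => π (torusLift (2 * S + 1) V e)) ∂μ| ≤
        C_A * (μ ((cls S) ⁻¹' {some zz})).toReal := by
      intro zz
      have h := norm_setIntegral_le_of_norm_le_const (μ := μ) (s := (cls S) ⁻¹' {some zz})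
        (f := fun V => A.F (fun e => π (torusLift (2 * S + 1) V e))) (C := C_A) (measure_lt_top μ _)
        (fun V _ => by rw [Real.norm_eq_abs]; exact hC_A _)
      rw [Real.norm_eq_abs, measureReal_def] at h
      exact h
    have hIz1 := hIle z
    have hIz'1 := hIle z'
    have hbound : |pz' * (∫ V in ((cls S) ⁻¹' {some z}), A.F (fun e => π (torusLift (2 * S + 1) V e)) ∂μ) -
        pz * (∫ V in ((cls S) ⁻¹' {some z'}), A.F (fun e => π (torusLift (2 * S + 1) V e)) ∂μ)| ≤ 2 * C_A * (pz * pz') := by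
      refine (abs_sub _ _).trans ?_
      rw [abs_mul, abs_mul, abs_of_nonneg hpz0, abs_of_nonneg hpz'0]
      calc pz' * |∫ V in ((cls S) ⁻¹' {some z}), A.F (fun e => π (torusLift (2 * S + 1) V e)) ∂μ| +
            pz * |∫ V in ((cls S) ⁻¹' {some z'}), A.F (fun e => π (torusLift (2 * S + 1) V e)) ∂μ|
          ≤ pz' * (C_A * pz) + pz * (C_A * pz') :=
            add_le_add (mul_le_mul_of_nonneg_left hIz1 hpz'0) (mul_le_mul_of_nonneg_left hIz'1 hpz0)
        _ = 2 * C_A * (pz * pz') := by ring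
    refine hbound.trans ?_
    have hpp : 0 ≤ pz * pz' := mul_nonneg hpz0 hpz'0
    have hrate : 2 * C_A ≤ (41 * K + C_A + 2 * C_A * Real.exp (4 * (thick A : ℝ))) * Real.exp (-(2 * (S : ℝ) + 1)) := by
      have hge : 1 ≤ Real.exp (4 * (thick A : ℝ)) * Real.exp (-(2 * (S : ℝ) + 1)) := by
        rw [← Real.exp_add]
        apply Real.one_le_exp
        have h' : ((2 * S + 2 : ℕ) : ℝ) ≤ ((4 * thick A : ℕ) : ℝ) := by exact_mod_cast (by omega)
        push_cast at h'
        linarith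
      have h1 : 0 ≤ (41 * K + C_A) * Real.exp (-(2 * (S : ℝ) + 1)) := by positivity
      nlinarith [hge, h1, hCA0]
    calc 2 * C_A * (pz * pz')
        ≤ (41 * K + C_A + 2 * C_A * Real.exp (4 * (thick A : ℝ))) * Real.exp (-(2 * (S : ℝ) + 1)) * (pz * pz') :=
          mul_le_mul_of_nonneg_right hrate hpp
      _ = (41 * K + C_A + 2 * C_A * Real.exp (4 * (thick A : ℝ))) * Real.exp (-(2 * (S : ℝ) + 1)) * pz * pz' := by ring

end Assembly

end Summit.QuantumFields.YangMills.Cruxes.IRcof.EquipartitionSeam.KernelBridges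

end
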